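import Mathlib
import HarnessLib
import Summits.HubbardSuperconductivity.HubbardSuperconductivity.Theorems.ChiralWindowCwKLChiralWindowLindhardD4
import Summits.HubbardSuperconductivity.HubbardSuperconductivity.Theorems.WeakCouplingBCSKlCertTPrimeD4Invariant

/-!
# Route `WeakCouplingBCS` — `D₄`-invariance of the Lindhard function of EVERY `t`–`t′` band
# (located input of «(KLSCAN)-TPRIME-SOUNDNESS» — conjunct 4 of p3's `KLTPAnalytic`; certificate half of stmt-HubbardSuperconductivity-0158; seat p4 g19)

The registered leaf `stub_klLindhardD4` (…ChiralWindowCwKLChiralWindowLindhardD4) proves `χ₀[ε₀](γ q) = χ₀[ε₀](q)` for the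
nearest-neighbour band only, although its change-of-variables row `kl_ld4_lindhard_comp` uses nothing about `ε₀` beyond `ε₀ ∘ T = ε₀`.
This file states that row for an ARBITRARY band (`klph_lindhard_comp`) and instantiates it for `ε_{t′} = squareDispersion 1 tp`, whose
`D₄`-invariance `klph_squareDispersion_rot/refl` is in …TPrimeD4Invariant:

* **`klph_lindhardD4 (tp μ : ℝ) (g : DihedralGroup 4) (q : Momentum) :
    lindhardFunction (squareDispersion 1 tp) μ (d4Momentum g q) = lindhardFunction (squareDispersion 1 tp) μ q`.**

No definitions; nothing asserts a margin, a window or superconductivity.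
References: S. Raghu, S. A. Kivelson, D. J. Scalapino, Phys. Rev. B 81 (2010) 224505, §II (5), §III (17).
-/

noncomputable section

-- the tree's namespace `Summit.<Summit>.<Problem>.Theorems` repeats the summit name by design (D-0017)
set_option linter.dupNamespace false

namespace Summit.HubbardSuperconductivity.HubbardSuperconductivity.Theorems

open MeasureTheory Literature.MathematicalPhysics.QuantumLattice

/-- **Change of variables, any band.** If `T` is an additive, volume-preserving measurable embedding of momentum space with
`T⁻¹ BZ = BZ` a.e. and `ε ∘ T = ε`, then `χ₀[ε](T q) = χ₀[ε](q)` for every `μ` (the Lindhard integrand satisfies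
`L(Tq, Tp) = L(q, p)` pointwise; no integrability needed). [folklore] -/
theorem klph_lindhard_comp {ε : Momentum → ℝ} {T : Momentum → Momentum}
    (hT : MeasurePreserving T (volume : Measure Momentum) volume) (hTe : MeasurableEmbedding T)
    (hBZ : T ⁻¹' brillouinZone =ᵐ[(volume : Measure Momentum)] brillouinZone)
    (hadd : ∀ p q, T (p + q) = T p + T q)
    (heps : ∀ k, ε (T k) = ε k) (μ : ℝ) (q : Momentum) :
    lindhardFunction ε μ (T q) = lindhardFunction ε μ q := by
  have hpt : ∀ p, lindhardIntegrand ε μ (T q) (T p) = lindhardIntegrand ε μ q p := by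
    intro p
    simp only [lindhardIntegrand, fermiOccupation, ← hadd, heps]
  unfold lindhardFunction
  congr 1
  calc ∫ p in brillouinZone, lindhardIntegrand ε μ (T q) p
      = ∫ p in T ⁻¹' brillouinZone, lindhardIntegrand ε μ (T q) (T p) :=
        (hT.setIntegral_preimage_emb hTe _ _).symm
    _ = ∫ p in T ⁻¹' brillouinZone, lindhardIntegrand ε μ q p := by
        simp only [hpt]
    _ = ∫ p in brillouinZone, lindhardIntegrand ε μ q p :=
        setIntegral_congr_set hBZ

/-- `χ₀[ε_{t′}] ∘ rot = χ₀[ε_{t′}]`. [folklore] -/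
theorem klph_lindhard_rot (tp μ : ℝ) (q : Momentum) :
    lindhardFunction (squareDispersion 1 tp) μ (rotMomentum q) = lindhardFunction (squareDispersion 1 tp) μ q :=
  klph_lindhard_comp kl_ld4_rot_measurePreserving.1 kl_ld4_rot_measurePreserving.2
    kl_ld4_rot_preimage_ae_eq kl_ld4_rot_add (klph_squareDispersion_rot tp) μ q

/-- `χ₀[ε_{t′}] ∘ refl = χ₀[ε_{t′}]`. [folklore] -/
theorem klph_lindhard_refl (tp μ : ℝ) (q : Momentum) :
    lindhardFunction (squareDispersion 1 tp) μ (reflMomentum q) = lindhardFunction (squareDispersion 1 tp) μ q :=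
  klph_lindhard_comp kl_ld4_refl_measurePreserving.1 kl_ld4_refl_measurePreserving.2
    kl_ld4_refl_preimage_ae_eq kl_ld4_refl_add (klph_squareDispersion_refl tp) μ q

/-- `χ₀[ε_{t′}] ∘ rotⁿ = χ₀[ε_{t′}]`. [folklore] -/
theorem klph_lindhard_rot_iterate (tp μ : ℝ) (n : ℕ) (q : Momentum) :
    lindhardFunction (squareDispersion 1 tp) μ (rotMomentum^[n] q) = lindhardFunction (squareDispersion 1 tp) μ q := by
  induction n generalizing q with
  | zero => rfl
  | succ n ih => rw [Function.iterate_succ_apply', klph_lindhard_rot, ih]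

/-- **`D₄`-invariance of the Lindhard function of the `t`–`t′` band**: `χ₀[ε_{t′}](γ q) = χ₀[ε_{t′}](q)` for every `t′`, `μ`,
`γ ∈ D₄`, `q` — the `t′`-general twin of `stub_klLindhardD4`. [cite: RaghuKivelsonScalapino2010, §II (5) and §III (17)] -/
theorem klph_lindhardD4 (tp μ : ℝ) (g : DihedralGroup 4) (q : Momentum) :
    lindhardFunction (squareDispersion 1 tp) μ (d4Momentum g q) = lindhardFunction (squareDispersion 1 tp) μ q := by
  cases g with
  | r i => exact klph_lindhard_rot_iterate tp μ i.val q
  | sr i =>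
    show lindhardFunction (squareDispersion 1 tp) μ (reflMomentum (rotMomentum^[i.val] q)) = _
    rw [klph_lindhard_refl, klph_lindhard_rot_iterate]

end Summit.HubbardSuperconductivity.HubbardSuperconductivity.Theorems

end
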